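import Summits.RiemannHypothesis.RiemannHypothesis.Theorems.WeilColumnThetaUC
import Summits.RiemannHypothesis.RiemannHypothesis.Theorems.WeilColumnPrimeTermMollLimit
import Summits.RiemannHypothesis.RiemannHypothesis.Theorems.WeilColumnThetaAtomLayer
import HarnessLib

/-!
# THETA certificate, tier 2 — E10: the analytic assembly in HYPOTHESIS form (RH-FREE)

Cell `rh-explicit`, WEIL column, seat cc-s2-3 gen23 (TIER2-SOUNDNESS-PLAN v1.1 §0/§2 E10/§6; cc-s2-1 gen22 TIER2-KERNEL-SPEC §0/§5).
Tier 1's `uc_of_loss_lt_gain_of_psi_le` (`WeilColumnThetaUCCheb`) hard-wires the closed-form `P.A`, `P.B`, the exponential-envelope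
prime side and `P.atom`. The tier-2 kernel exports instead cellwise numbers `Ā`, `B̄`, a prime-side value `primesC + cross`, and a
layer constant. This file assembles UC(q) from such numbers taken as HYPOTHESES, so that weil-1's E2/E3/CrossTermT2 files and
cc-s2-1's `certify_sound` plug in by name, whatever their final field layout:

* `ucT2_of_bounds_of_GRdecay` / **`ucT2_of_bounds`**: for an admissible row with consecutive primes `q < q⁺`, given
  `∫‖T_R⁻‖² ≤ Ā` (all `R ≥ 0`), `∫‖(T⁻)′‖² ≤ B̄`, `‖weilPrimeTerm (T_R⁻ ⋆ T̃_R⁻)‖ ≤ Pv` (all `R ≥ 0`; the UNMOLLIFIED truncated tail —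
  cf. E6/E7), a bottom-layer majorant `‖Θ(e^v)‖ ≤ L` on `[−a, 2δ − a]` (E8), `0 < t₀ ≤ 1`, `0 < J`, and the certificate inequality
  `Pv + arch(Ā, B̄, t₀) + atom(L) < gain J` — **`a*(S_q) < (log q⁺)/2`**.

Chain: Step 2 (`norm_weilMellin_GROdd_moll_le`, unchanged) ⇒ bracket `β(R) → 0` (`exists_bracket_tendsto_zero`); E7
`eventually_re_weilQuadratic_moll_le` on `f = T_R⁻` at each fixed `R`; `∫‖(T_R⁻)′‖² → ∫‖(T⁻)′‖²` (`tendsto_integral_norm_sq_deriv_TROdd`);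
order of limits `eventually_le_of_R_steps`; spine `weilSemilocalThreshold_lt_of_full_le_of_layer`; `gain_le`.
Upper-clause bookkeeping only; nothing here bears on the truth of RH.
-/

noncomputable section

set_option linter.dupNamespace false

open Complex Set MeasureTheory Filter
open scoped Real Topology ComplexConjugate

namespace Summit.RiemannHypothesis.RiemannHypothesis.Theorems.WeilColumn.ThetaMellin

open Literature.NumberTheory.LFunctions Literature.NumberTheory.LFunctions.WeilContinuous ThetaParams

namespace ThetaParams

variable {P : ThetaParams}

/-- `T_R⁻` is odd. [folklore] -/
theorem TROdd_neg (P : ThetaParams) (R x : ℝ) : P.TROdd R (-x) = -P.TROdd R x := by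
  unfold TROdd; rw [neg_neg]; ring

/-- The shifted arch bracket `B′_R/2·e^{t₀/2}·t₀²/2 + Ā·(…)₊`, `B′_R = ∫‖(T_R⁻)′‖² + (B̄ − ∫‖(T⁻)′‖²)`, tends to
`B̄/2·e^{t₀/2}·t₀²/2 + Ā·(…)₊` as `R → ∞` (tier 1's `tendsto_archR` with `P.A, P.B ↦ Ā, B̄`). [folklore] -/
theorem tendsto_archR_of {qn : ℕ} (hP : P.Admissible qn) (t₀ Abar Bbar : ℝ) :
    Tendsto (fun R : ℝ ↦ ((∫ x, ‖deriv (P.TROdd R) x‖ ^ 2) + (Bbar - ∫ x, ‖deriv P.TOdd x‖ ^ 2)) / 2 * Real.exp (t₀ / 2) *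
        t₀ ^ 2 / 2 + Abar * max 0 (2 * Jexplicit t₀ - Real.log (4 * π) - Real.eulerMascheroniConstant - archC₁))
      atTop (𝓝 (Bbar / 2 * Real.exp (t₀ / 2) * t₀ ^ 2 / 2 +
        Abar * max 0 (2 * Jexplicit t₀ - Real.log (4 * π) - Real.eulerMascheroniConstant - archC₁))) := by
  have hΘ' : ∀ u : ℝ, 0 < u → HasDerivAt P.Θ (deriv P.Θ u) u := fun u hu ↦ P.hasDerivAt_deriv_Θ hP hu
  have hlim := P.tendsto_integral_norm_sq_deriv_TROdd hP hΘ' (P.D2_on_Ioc hP)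
  have hB : Tendsto (fun R : ℝ ↦ (∫ x, ‖deriv (P.TROdd R) x‖ ^ 2) + (Bbar - ∫ x, ‖deriv P.TOdd x‖ ^ 2)) atTop (𝓝 Bbar) := by
    have h := hlim.add_const (Bbar - ∫ x, ‖deriv P.TOdd x‖ ^ 2)
    rw [add_sub_cancel] at h
    exact h
  exact (((hB.div_const 2).mul_const _).mul_const _ |>.div_const 2).add_const _

/-- **E10 MODULO STEP 2.** The tier-2 analytic assembly with the Step-2 decay of `GR_k` as a hypothesis (shape of
`exists_bracket_tendsto_zero`): cellwise numbers `Ā, B̄`, an unmollified truncated-tail prime bound `Pv`, a layer constant `L`,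
and `Pv + arch(Ā, B̄, t₀) + atom(L) < gain J` give `a*(S_q) < (log q⁺)/2`. [TIER2-SOUNDNESS-PLAN §0/E10; RH-FREE] -/
theorem ucT2_of_bounds_of_GRdecay {qn : ℕ} (hP : P.Admissible qn) (hcons : Handoff.ConsecutivePrimes P.q qn)
    {Abar Bbar Pv L t₀ : ℝ} {J : ℕ}
    (hAR : ∀ R : ℝ, 0 ≤ R → ∫ x, ‖P.TROdd R x‖ ^ 2 ≤ Abar)
    (hB : ∫ x, ‖deriv P.TOdd x‖ ^ 2 ≤ Bbar)
    (hprime : ∀ R : ℝ, 0 ≤ R → ‖weilPrimeTerm (weilConv (P.TROdd R) (weilReflect (P.TROdd R)))‖ ≤ Pv)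
    (hL : 0 ≤ L) (hΘL : ∀ v : ℝ, -P.a ≤ v → v ≤ 2 * P.δ - P.a → ‖P.Θ (Real.exp v)‖ ≤ L)
    (ht₀ : 0 < t₀) (ht₁ : t₀ ≤ 1) (hJ : 0 < J)
    (hlg : Pv + (Bbar / 2 * Real.exp (t₀ / 2) * t₀ ^ 2 / 2 +
        Abar * max 0 (2 * Jexplicit t₀ - Real.log (4 * π) - Real.eulerMascheroniConstant - archC₁)) +
      2 * Real.log P.q / Real.sqrt P.q *
        (4 * P.δ * Real.exp P.δ * P.hmax * L * P.chiL + 2 * P.δ * (Real.exp P.δ / Real.sqrt P.q) * L ^ 2 * P.chiL ^ 2)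
      < P.gain J)
    {WG : ℝ → ℝ} {R₁ : ℝ} (hWG0 : ∀ R, R₁ ≤ R → 0 ≤ WG R) (hWGlim : Tendsto WG atTop (𝓝 0))
    (hG : ∀ R : ℝ, R₁ ≤ R → ∀ k : ℕ, ∀ ρ : ℂ, ρ ∈ RHWave0.riemannZetaNontrivialZeros →
      ‖weilMellin (weilConv (P.GROdd R) (moll k)) ρ‖ ≤ WG R / ‖ρ - 1 / 2‖) :
    MotivicDoor.SemilocalThreshold.weilSemilocalThreshold (Nat.primesBelow P.q) < Real.log qn / 2 := by
  have hq1 : 1 ≤ P.q := le_trans (by norm_num) hcons.1.two_le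
  have hm2 : 2 ≤ P.m := le_trans (by norm_num) hP.three_le
  have hΘ' : ∀ u : ℝ, 0 < u → HasDerivAt P.Θ (deriv P.Θ u) u := fun u hu ↦ P.hasDerivAt_deriv_Θ hP hu
  obtain ⟨β, hβ, hbr⟩ := exists_bracket_tendsto_zero hP hΘ' (P.continuousOn_deriv_Θ hP) (P.D2_on_Ioc hP) hWG0 hWGlim hG
  set R₀ : ℝ := max (max P.a R₁) 0 with hR₀
  set arch₂ : ℝ := Bbar / 2 * Real.exp (t₀ / 2) * t₀ ^ 2 / 2 +
    Abar * max 0 (2 * Jexplicit t₀ - Real.log (4 * π) - Real.eulerMascheroniConstant - archC₁) with harch₂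
  -- the steps: `R` fixed, `k → ∞`
  have hsteps : ∀ R : ℝ, R₀ ≤ R → ∀ e : ℝ, 0 < e → ∀ᶠ k : ℕ in atTop,
      (fun k : ℕ ↦ (weilQuadratic (P.phi k)).re) k ≤ Pv + e +
        (fun R : ℝ ↦ ((∫ x, ‖deriv (P.TROdd R) x‖ ^ 2) + (Bbar - ∫ x, ‖deriv P.TOdd x‖ ^ 2)) / 2 * Real.exp (t₀ / 2) *
          t₀ ^ 2 / 2 + Abar * max 0 (2 * Jexplicit t₀ - Real.log (4 * π) - Real.eulerMascheroniConstant - archC₁)) R +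
        β R := by
    intro R hR e he
    have hR' : max P.a R₁ ≤ R := le_trans (le_max_left _ _) hR
    have hR0 : 0 ≤ R := le_trans (le_max_right _ _) hR
    have hBR : ∫ x, ‖deriv (P.TROdd R) x‖ ^ 2 ≤
        (∫ x, ‖deriv (P.TROdd R) x‖ ^ 2) + (Bbar - ∫ x, ‖deriv P.TOdd x‖ ^ 2) := by linarith
    have h7 := eventually_re_weilQuadratic_moll_le (contDiff_one_TROdd hP R) (hasCompactSupport_TROdd hP R)
      (P.TROdd_neg R) (hAR R hR0) hBR ht₀ ht₁ he
    filter_upwards [h7] with k hk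
    have h1 := hbr k R hR'
    have h2 := hprime R hR0
    linarith
  have hBfull : ∀ e : ℝ, 0 < e → ∀ᶠ k : ℕ in atTop, (weilQuadratic (P.phi k)).re ≤ (Pv + arch₂) + e := by
    intro e he
    filter_upwards [eventually_le_of_R_steps hsteps (tendsto_archR_of hP t₀ Abar Bbar) hβ he] with k hk
    simpa only [harch₂] using hk
  have hgain := P.gain_le hP.delta_pos hm2 hJ hq1
  refine weilSemilocalThreshold_lt_of_full_le_of_layer hP hcons hL hΘL hBfull ?_
  rw [harch₂]
  linarith

/-- **E10 — THE TIER-2 ANALYTIC ASSEMBLY IN HYPOTHESIS FORM.** For an admissible row `P` with consecutive primes `q < q⁺`: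
if `∫‖T_R⁻‖² ≤ Ā` for every `R ≥ 0` (E3), `∫‖(T⁻)′‖² ≤ B̄` (E3), `‖weilPrimeTerm (T_R⁻ ⋆ T̃_R⁻)‖ ≤ Pv` for every `R ≥ 0` (D6′ +
CrossTermT2 on the UNMOLLIFIED truncated tail), `‖Θ(e^v)‖ ≤ L` on the bottom layer `v ∈ [−a, 2δ − a]` with `L ≥ 0` (E8
`layer_majorant_ML₂`), `0 < t₀ ≤ 1`, `0 < J`, and
`Pv + (B̄/2·e^{t₀/2}·t₀²/2 + Ā·(2·Jexplicit t₀ − log 4π − γ − archC₁)₊) + (2 log q/√q)·(4δe^δ·h_max·L·χ_L + 2δ(e^δ/√q)·L²·χ_L²) < gain J`,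
then **`a*(S_q) < (log q⁺)/2`**. Step 2 is plugged in exactly as in tier 1's `uc_of_loss_lt_gain_of_psi_le`.
[TIER2-SOUNDNESS-PLAN v1.1 §0/E10; THETA-CERT-cc6 §E6; RH-FREE] -/
theorem ucT2_of_bounds {qn : ℕ} (hP : P.Admissible qn) (hcons : Handoff.ConsecutivePrimes P.q qn)
    {Abar Bbar Pv L t₀ : ℝ} {J : ℕ}
    (hAR : ∀ R : ℝ, 0 ≤ R → ∫ x, ‖P.TROdd R x‖ ^ 2 ≤ Abar)
    (hB : ∫ x, ‖deriv P.TOdd x‖ ^ 2 ≤ Bbar)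
    (hprime : ∀ R : ℝ, 0 ≤ R → ‖weilPrimeTerm (weilConv (P.TROdd R) (weilReflect (P.TROdd R)))‖ ≤ Pv)
    (hL : 0 ≤ L) (hΘL : ∀ v : ℝ, -P.a ≤ v → v ≤ 2 * P.δ - P.a → ‖P.Θ (Real.exp v)‖ ≤ L)
    (ht₀ : 0 < t₀) (ht₁ : t₀ ≤ 1) (hJ : 0 < J)
    (hlg : Pv + (Bbar / 2 * Real.exp (t₀ / 2) * t₀ ^ 2 / 2 +
        Abar * max 0 (2 * Jexplicit t₀ - Real.log (4 * π) - Real.eulerMascheroniConstant - archC₁)) +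
      2 * Real.log P.q / Real.sqrt P.q *
        (4 * P.δ * Real.exp P.δ * P.hmax * L * P.chiL + 2 * P.δ * (Real.exp P.δ / Real.sqrt P.q) * L ^ 2 * P.chiL ^ 2)
      < P.gain J) :
    MotivicDoor.SemilocalThreshold.weilSemilocalThreshold (Nat.primesBelow P.q) < Real.log qn / 2 := by
  obtain ⟨Lψ, hL0, hLψ⟩ := exists_abs_deriv_smoothTransition_le
  have hΘ' : ∀ u : ℝ, 0 < u → HasDerivAt P.Θ (deriv P.Θ u) u := fun u hu ↦ P.hasDerivAt_deriv_Θ hP hu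
  have hu : 0 < P.u₁ := Real.exp_pos _
  have hM : 0 ≤ P.M := by
    have h := le_trans (norm_nonneg _) (P.norm_Θ_le' hP Real.zero_lt_one)
    have hc : 0 < (1 / P.u₁) ^ P.m := by positivity
    exact le_of_mul_le_mul_right (by rwa [zero_mul]) hc
  have hM₁ : 0 ≤ P.M₁ := by
    have h := le_trans (norm_nonneg _) (P.D2_on_Ioc hP P.u₁ ⟨hu, le_rfl⟩)
    rwa [div_self hu.ne', one_pow, mul_one] at h
  have hm1 : (0 : ℝ) < ((P.m : ℝ) - 1 / 2) - 1 / 2 := by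
    have : (3 : ℝ) ≤ P.m := by exact_mod_cast hP.three_le
    linarith
  have hexp : Tendsto (fun R : ℝ ↦ Real.exp ((((P.m : ℝ) - 1 / 2) - 1 / 2) * (-R))) atTop (𝓝 0) := by
    have h1 : Tendsto (fun R : ℝ ↦ (((P.m : ℝ) - 1 / 2) - 1 / 2) * (-R)) atTop atBot :=
      tendsto_neg_atTop_atBot.const_mul_atBot hm1
    exact Real.tendsto_exp_atBot.comp h1
  have hWGlim : Tendsto (fun R : ℝ ↦ Real.exp (1 / 2) * (2 *
      ((((3 / 2 + Lψ) * P.M) / P.u₁ ^ P.m + P.M₁ / P.u₁ ^ (P.m - 1)) * Real.exp ((((P.m : ℝ) - 1 / 2) - 1 / 2) * (-R)) /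
        (((P.m : ℝ) - 1 / 2) - 1 / 2)))) atTop (𝓝 0) := by
    simpa using (((hexp.const_mul _).div_const (((P.m : ℝ) - 1 / 2) - 1 / 2)).const_mul 2).const_mul (Real.exp (1 / 2))
  refine ucT2_of_bounds_of_GRdecay hP hcons hAR hB hprime hL hΘL ht₀ ht₁ hJ hlg (R₁ := P.a)
    (WG := fun R : ℝ ↦ Real.exp (1 / 2) * (2 *
      ((((3 / 2 + Lψ) * P.M) / P.u₁ ^ P.m + P.M₁ / P.u₁ ^ (P.m - 1)) * Real.exp ((((P.m : ℝ) - 1 / 2) - 1 / 2) * (-R)) /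
        (((P.m : ℝ) - 1 / 2) - 1 / 2))))
    (fun R _ ↦ by positivity) hWGlim fun R hR k ρ hρ ↦ ?_
  exact P.norm_weilMellin_GROdd_moll_le hP hΘ' (P.continuousOn_deriv_Θ hP) (P.D2_on_Ioc hP) hL0 hLψ hR k hρ

/-! ## Glue for the prime-side hypothesis `hprime` (appended by cc-s2-3 gen23, 19:2xZ; `‖T_R‖ ≤ ‖T‖` is weil-1's `norm_TR_le_norm_T` in `WeilColumnThetaEnvelopeE2`) -/

/-- **`T_R⁻` vanishes beyond radius `R + 1`** (`R ≥ 0`) — the `hga` input of `ThetaPrime.norm_weilPrimeTerm_le_of_oddTail_cell_of_radius`.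
[folklore] -/
theorem TROdd_eq_zero_of_radius {qn : ℕ} (hP : P.Admissible qn) {R : ℝ} (hR : 0 ≤ R) {u : ℝ} (hu : R + 1 < |u|) :
    P.TROdd R u = 0 := by
  refine image_eq_zero_of_notMem_tsupport fun h ↦ ?_
  have hmem := tsupport_TROdd_subset hP hR h
  have : |u| ≤ R + 1 := abs_le.2 ⟨by linarith [hmem.1], hmem.2⟩
  linarith

end ThetaParams

end Summit.RiemannHypothesis.RiemannHypothesis.Theorems.WeilColumn.ThetaMellin

end
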